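import Mathlib
import Literature.LinearAlgebra.QuadraticForm.DefiniteUnimodularPolynomialLattice
import HarnessLib

/-!
# Self-adjoint matrices for a positive unimodular form over `ℝ[x]` are symmetrisable

Topic `Literature/LinearAlgebra/QuadraticForm`. The matrix form of the last step of the proof of
C. Hanselka, *Characteristic polynomials of symmetric matrices over the univariate polynomial
ring*, J. Algebra 487 (2017) 340–356, **§5** ("Since `μ` is obviously self-adjoint with respect
to `β`, its representing matrix `M ∈ Matₙ A` with respect to the orthonormal basis `ℬ` of `I` is
symmetric, hence `M` is a symmetric spectral representation of `f` over `A`"):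

* `exists_isSymm_charpoly_eq_of_selfAdjoint` — if `N ∈ Mₙ(ℝ[x])` is self-adjoint for a
  symmetric form with Gram matrix `G ∈ Mₙ(ℝ[x])` (`NᵀG = GN`) which is unimodular (`det G` a
  unit) and positive semidefinite at every real point, then `N` is similar over `ℝ[x]` to a
  SYMMETRIC matrix: with an orthonormal basis `P` of `G` (`PᵀGP = 1`,
  `exists_isUnit_transpose_mul_mul_eq_one_of_posSemidef`, the Harder–Djoković step) the matrix
  `P⁻¹NP` is symmetric and has the characteristic polynomial of `N`.

Thus a symmetric spectral representation of a monic `f ∈ ℝ[x][t]` (Hanselka's Theorem 1, the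
hypothesis `H` of `laxConjecture_of_symmSpectralRepresentation`) follows from ANY spectral
representation `N` of `f` over `ℝ[x]` (e.g. multiplication by `t` on an `ℝ[x]`-lattice of
`ℝ(x)[t]/(f)`) that is self-adjoint for some unimodular, pointwise positive semidefinite
symmetric form — the data `(I, c)` of [Hanselka2017, Lemma 2.1 and §5].

## References

* [Hanselka2017] C. Hanselka, J. Algebra 487 (2017) 340–356: §5 (end of the proof of Thm. 1),
  Thm. 1.2.
-/

noncomputable section

open Polynomial Matrix

namespace Literature.LinearAlgebra.QuadraticForm

variable {n : Type*} [Fintype n] [DecidableEq n]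

/-- **Symmetrisation of a self-adjoint matrix by an orthonormal basis** ([Hanselka2017, §5,
last paragraph of the proof of Thm. 1], matrix form): if `NᵀG = GN` with `G ∈ Mₙ(ℝ[x])`
positive semidefinite at every real point and `det G` a unit, then there is a symmetric
`M ∈ Mₙ(ℝ[x])` with `charpoly M = charpoly N` (namely `M = P⁻¹NP` for any `P` with
`PᵀGP = 1`). [cite: Hanselka2017, §5 (proof of Theorem 1, last paragraph) with Thm. 1.2] -/
theorem exists_isSymm_charpoly_eq_of_selfAdjoint (N G : Matrix n n ℝ[X]) (hNG : Nᵀ * G = G * N)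
    (hG : ∀ a : ℝ, (G.map (Polynomial.eval a)).PosSemidef) (hdet : IsUnit G.det) :
    ∃ M : Matrix n n ℝ[X], M.IsSymm ∧ M.charpoly = N.charpoly := by
  obtain ⟨P, hP, hPGP⟩ := exists_isUnit_transpose_mul_mul_eq_one_of_posSemidef G hG hdet
  obtain ⟨u, rfl⟩ := hP
  have hGsymm : G.IsSymm := isSymm_of_forall_isHermitian G fun a => (hG a).1
  have hinv : (u : Matrix n n ℝ[X])⁻¹ = (u : Matrix n n ℝ[X])ᵀ * G := Matrix.inv_eq_left_inv hPGP
  have hinvT : ((u : Matrix n n ℝ[X])⁻¹)ᵀ = G * (u : Matrix n n ℝ[X]) := by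
    rw [hinv, transpose_mul, transpose_transpose, hGsymm.eq]
  refine ⟨(u : Matrix n n ℝ[X])⁻¹ * N * (u : Matrix n n ℝ[X]), ?_, ?_⟩
  · rw [Matrix.IsSymm, transpose_mul, transpose_mul, hinvT, hinv, ← Matrix.mul_assoc Nᵀ, hNG]
    simp only [Matrix.mul_assoc]
  · exact charpoly_units_conj' u N

/-- The same statement with the similarity made explicit: `N` is conjugate over `ℝ[x]`, by an
invertible matrix, to a symmetric matrix. [cite: Hanselka2017, §5 (proof of Theorem 1, last
paragraph) with Thm. 1.2] -/
theorem exists_isUnit_conj_isSymm_of_selfAdjoint (N G : Matrix n n ℝ[X]) (hNG : Nᵀ * G = G * N)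
    (hG : ∀ a : ℝ, (G.map (Polynomial.eval a)).PosSemidef) (hdet : IsUnit G.det) :
    ∃ P : Matrix n n ℝ[X], IsUnit P ∧ (P⁻¹ * N * P).IsSymm := by
  obtain ⟨P, hP, hPGP⟩ := exists_isUnit_transpose_mul_mul_eq_one_of_posSemidef G hG hdet
  obtain ⟨u, rfl⟩ := hP
  have hGsymm : G.IsSymm := isSymm_of_forall_isHermitian G fun a => (hG a).1
  have hinv : (u : Matrix n n ℝ[X])⁻¹ = (u : Matrix n n ℝ[X])ᵀ * G := Matrix.inv_eq_left_inv hPGP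
  have hinvT : ((u : Matrix n n ℝ[X])⁻¹)ᵀ = G * (u : Matrix n n ℝ[X]) := by
    rw [hinv, transpose_mul, transpose_transpose, hGsymm.eq]
  refine ⟨(u : Matrix n n ℝ[X]), u.isUnit, ?_⟩
  rw [Matrix.IsSymm, transpose_mul, transpose_mul, hinvT, hinv, ← Matrix.mul_assoc Nᵀ, hNG]
  simp only [Matrix.mul_assoc]

end Literature.LinearAlgebra.QuadraticForm
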